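import Summits.ResolutionOfSingularities.ResolutionOfSingularities.Theorems.EquisingularLiftEquisingularLiftNatSecondOrderA3Recognition
import HarnessLib

/-!
# [OURS] THE `A`-LADDER STEP in polynomial currency: for ANY vertex chart `f = y₀y₁ + Ψ`, `Ψ ∈ (y)³` (tangent cone two transversal planes),
# the chart-`2` strict transform is `G₂ = c·T₂ + (T₀T₁ + T₂·L) + T₂·p₂` (`L` a linear form, `p₂ ∈ (T)²`): if `c ≠ 0` the point is ONE-STEP
# (explicit strict transforms, every characteristic); if `c = 0` the unique candidate exceptional singular point has tangent cone `T₀T₁ + T₂L`,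
# AGAIN a quadric through `T₀T₁` — the class «multiplicity 2, tangent cone ⊇ two transversal planes» REPRODUCES ITSELF under point blow-up
# (cruxes `Theses.EquisingularLift.EquisingularLiftNat` / `…NatThree` / `EquisingularLift`, stmt-ResolutionOfSingularities-20038 / -20148 / -15660)

[OURS · leafhand-res-equisingularlift-11 g0, 2026-08-31; cell `pub/decomp-res`] AI-produced, weaker than expert review; NOT a statement of any manuscript;
nothing here proves resolution of singularities in positive characteristic.  DEF-FREE helper; no `sorry`; standard axioms; ZERO named hypotheses.

Sequel of ✓ `…NatSecondOrderAPoints` (p832392) and ✓ `…NatSecondOrderA3Recognition`.  The point of this file is the RECURSIVE SHAPE behind «`A_k`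
singularities are absolutely isolated» (`A_k ↦ A_{k-2}` under the blow-up of the point), in the tree's polynomial currency and with no normal form assumed:

* `SecondOrderPoint.exists_split_const_linear` — ORDER SPLITTING to second order: every `R ∈ K[T]` is `C(c) + L + p₂` with `L` a linear form and
  `p₂ ∈ (T)²` (✓ `sub_homogeneousComponent_mem_pow_succ` of …NatSecondOrderA3Recognition, twice);
* `SecondOrderPoint.mem_span_of_isHomogeneous_succ` — a form of positive degree lies in `(T)`;
* ★★★ `SecondOrderPoint.A_ladder_chart₂` — `f = y₀y₁ + Ψ`, `Ψ ∈ (y)³`, ANY field: `f(T₂T₀, T₂T₁, T₂) = T₂²·G₂` with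
  `G₂ = C(c)·T₂ + (T₀T₁ + T₂·L) + T₂·p₂`, `L` a linear form, `p₂ ∈ (T)²`, `T₀T₁ + T₂L` a quadratic FORM; a prime `P ∋ T₂` containing `∂₀G₂, ∂₁G₂`
  contains all `T_i`; and **if `c ≠ 0` the Jacobian test passes at EVERY prime `P ∋ T₂`** (chart `2` regular along `E`; with the graph charts `0, 1`
  of ✓ `A_charts_regular_off_origin₂` the point is ONE-STEP — the `A₂` regime, here for every `Ψ` with a `y₂³` term, every characteristic, with
  explicit `G`'s rather than through (FO));
* ★ `SecondOrderPoint.A_ladder_oneStep_of_ne_zero` — the packaged one-step data (all three charts) in the regime `c ≠ 0`.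

In the regime `c = 0` the exceptional origin has multiplicity `≥ 2` with tangent cone the quadric `T₀T₁ + T₂L ∋ T₀T₁`: writing `L = αT₀ + βT₁ + γT₂`,
`T₀T₁ + T₂L = (T₀ + βT₂)(T₁ + αT₂) + (γ - αβ)T₂²` is a NODE (`γ ≠ αβ`: ✓ `firstOrder_node_disc`, level `1`, the `A₃` case) or again two transversal
planes in the linear coordinates `T₀ + βT₂, T₁ + αT₂, T₂` (`γ = αβ`: the `A_k`, `k ≥ 4`, case — recurse after the linear change, ✓ …NatFirstOrderLinSubst).
NOT done here: the termination measure of the recursion (the `k` of `A_k` is not a polynomial-currency datum without a normal form) and the scheme-side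
bridge to the depth towers.  Honest label: pure algebra; closes no registered stub.

References: [Hartshorne1977, I Thm. 5.1, I Ex. 5.6, II Ex. 7.12]; [Lipman1969, §24]; through the cited tree files.
-/

set_option linter.dupNamespace false -- mandated namespace `Summit.<Summit>.<Problem>` of this single-conjunct summit

noncomputable section

open MvPolynomial

namespace Summit.ResolutionOfSingularities.ResolutionOfSingularities.Cruxes.EquisingularLiftNat.Sections

namespace SecondOrderPoint

variable (K : Type) [Field K] {n : ℕ}

/-! ## Order splitting to second order -/

/-- **Every polynomial splits as constant + linear form + order `≥ 2`.** [folklore] -/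
theorem exists_split_const_linear (R : MvPolynomial (Fin n) K) :
    ∃ L p₂ : MvPolynomial (Fin n) K, L.IsHomogeneous 1 ∧ p₂ ∈ Ideal.span (Set.range (X : Fin n → MvPolynomial (Fin n) K)) ^ 2 ∧
      R = C (coeff 0 R) + L + p₂ := by
  have h0 : R ∈ Ideal.span (Set.range (X : Fin n → MvPolynomial (Fin n) K)) ^ 0 := by
    rw [pow_zero, Ideal.one_eq_top]; exact Submodule.mem_top
  have h1 := sub_homogeneousComponent_mem_pow_succ K h0
  rw [homogeneousComponent_zero, zero_add] at h1
  have h2 := sub_homogeneousComponent_mem_pow_succ K h1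
  refine ⟨homogeneousComponent 1 (R - C (coeff 0 R)), (R - C (coeff 0 R)) - homogeneousComponent 1 (R - C (coeff 0 R)),
    homogeneousComponent_isHomogeneous 1 _, h2, by ring⟩

/-- **A form of positive degree lies in the ideal of the variables.** [folklore] -/
theorem mem_span_of_isHomogeneous_succ {L : MvPolynomial (Fin n) K} {k : ℕ} (hL : L.IsHomogeneous (k + 1)) :
    L ∈ Ideal.span (Set.range (X : Fin n → MvPolynomial (Fin n) K)) := by
  change L ∈ MvPolynomial.idealOfVars (Fin n) K
  rw [← pow_one (MvPolynomial.idealOfVars (Fin n) K), MvPolynomial.mem_pow_idealOfVars_iff']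
  intro x hx
  have hx0 : x = 0 := (Finsupp.degree_eq_zero_iff x).mp (Nat.lt_one_iff.mp hx)
  subst hx0
  by_contra h
  have hdeg := hL h
  simp at hdeg

/-! ## ★★★ The ladder step -/

/-- ★★★ **THE `A`-LADDER STEP, chart `2`.**  `f = y₀y₁ + Ψ`, `Ψ ∈ (y)³`, any field.  There are `c ∈ K`, a linear form `L` and `p₂ ∈ (T)²` such that,
with `G₂ = C(c)·T₂ + (T₀T₁ + T₂·L) + T₂·p₂`: (i) `f(T₂T₀, T₂T₁, T₂) = T₂²·G₂`; (ii) `T₀T₁ + T₂L` is a quadratic form (the tangent cone of the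
exceptional origin when `c = 0`); (iii) an ideal containing `T₂`, `∂₀G₂`, `∂₁G₂` contains all `T_i`; (iv) if `c ≠ 0`, at every prime `P ∋ T₂` some
`∂_jG₂ ∉ P` — chart `2` is regular along the exceptional divisor. [cite: Hartshorne1977, I Thm. 5.1, II Ex. 7.12] -/
theorem A_ladder_chart₂ {Ψ : MvPolynomial (Fin 3) K} (hΨ : Ψ ∈ Ideal.span (Set.range (X : Fin 3 → MvPolynomial (Fin 3) K)) ^ 3) :
    ∃ (c : K) (L p₂ : MvPolynomial (Fin 3) K), L.IsHomogeneous 1 ∧ p₂ ∈ Ideal.span (Set.range (X : Fin 3 → MvPolynomial (Fin 3) K)) ^ 2 ∧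
      aeval (fun j => X 2 * Function.update (X : Fin 3 → MvPolynomial (Fin 3) K) 2 1 j) (X 0 * X 1 + Ψ) =
        X 2 ^ 2 * (C c * X 2 + (X 0 * X 1 + X 2 * L) + X 2 * p₂) ∧
      (X 0 * X 1 + X 2 * L : MvPolynomial (Fin 3) K).IsHomogeneous 2 ∧
      (∀ P : Ideal (MvPolynomial (Fin 3) K), (X 2 : MvPolynomial (Fin 3) K) ∈ P →
        pderiv 0 (C c * X 2 + (X 0 * X 1 + X 2 * L) + X 2 * p₂) ∈ P → pderiv 1 (C c * X 2 + (X 0 * X 1 + X 2 * L) + X 2 * p₂) ∈ P →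
        ∀ i, (X i : MvPolynomial (Fin 3) K) ∈ P) ∧
      (c ≠ 0 → ∀ P : Ideal (MvPolynomial (Fin 3) K), P.IsPrime → (X 2 : MvPolynomial (Fin 3) K) ∈ P →
        ∃ j, pderiv j (C c * X 2 + (X 0 * X 1 + X 2 * L) + X 2 * p₂) ∉ P) := by
  obtain ⟨R, hR⟩ := FirstOrderPoint.exists_aeval_subst_eq_pow_mul K 2 hΨ
  obtain ⟨L, p₂, hL, hp₂, hsplit⟩ := exists_split_const_linear K R
  set I : Ideal (MvPolynomial (Fin 3) K) := Ideal.span (Set.range (X : Fin 3 → MvPolynomial (Fin 3) K)) with hIdef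
  have hprod : (C (coeff 0 R) * X 2 + (X 0 * X 1 + X 2 * L) + X 2 * p₂ : MvPolynomial (Fin 3) K) - X 0 * X 1 ∈
      Ideal.span {(X 2 : MvPolynomial (Fin 3) K)} :=
    Ideal.mem_span_singleton'.mpr ⟨C (coeff 0 R) + L + p₂, by ring⟩
  have hR' : aeval (fun j => X 2 * Function.update (X : Fin 3 → MvPolynomial (Fin 3) K) 2 1 j) Ψ =
      X 2 ^ 3 * (C (coeff 0 R) + L + p₂) := by
    rw [hR]; exact congrArg (fun q => X 2 ^ 3 * q) hsplit
  refine ⟨coeff 0 R, L, p₂, hL, hp₂, ?_, ?_, ?_, ?_⟩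
  · -- (i)
    rw [map_add, aeval_subst_X_mul_X_of_ne K 2 0 1 (by decide) (by decide), hR']
    ring
  · -- (ii)
    have h := ((isHomogeneous_X K (0 : Fin 3)).mul (isHomogeneous_X K (1 : Fin 3))).add ((isHomogeneous_X K (2 : Fin 3)).mul hL)
    simpa using h
  · -- (iii)
    intro P h2 h0 h1 i
    exact forall_X_mem_of_sub_mul_mem_span₃ K hprod P h2 h0 h1 i
  · -- (iv)
    intro hc P hP h2
    by_contra hall
    push Not at hall
    have hT : ∀ i, (X i : MvPolynomial (Fin 3) K) ∈ P := forall_X_mem_of_sub_mul_mem_span₃ K hprod P h2 (hall 0) (hall 1)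
    have hIP : I ≤ P := Ideal.span_le.mpr (Set.range_subset_iff.mpr fun i => hT i)
    have hLP : L ∈ P := hIP (mem_span_of_isHomogeneous_succ K hL)
    have hp₂P : p₂ ∈ P := hIP (Ideal.pow_le_self (by norm_num) hp₂)
    have hd2 : pderiv 2 (C (coeff 0 R) * X 2 + (X 0 * X 1 + X 2 * L) + X 2 * p₂ : MvPolynomial (Fin 3) K) =
        C (coeff 0 R) + (L + X 2 * pderiv 2 L) + (p₂ + X 2 * pderiv 2 p₂) := by
      simp only [map_add, pderiv_mul, pderiv_C, pderiv_X_self, pderiv_X_of_ne (show (0 : Fin 3) ≠ 2 by decide),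
        pderiv_X_of_ne (show (1 : Fin 3) ≠ 2 by decide)]
      ring
    have h := hall 2
    rw [hd2] at h
    have hC : (C (coeff 0 R) : MvPolynomial (Fin 3) K) ∈ P := by
      have e : (C (coeff 0 R) : MvPolynomial (Fin 3) K) =
          (C (coeff 0 R) + (L + X 2 * pderiv 2 L) + (p₂ + X 2 * pderiv 2 p₂)) - ((L + X 2 * pderiv 2 L) + (p₂ + X 2 * pderiv 2 p₂)) := by ring
      rw [e]
      exact P.sub_mem h (P.add_mem (P.add_mem hLP (P.mul_mem_right _ (hT 2))) (P.add_mem hp₂P (P.mul_mem_right _ (hT 2))))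
    exact hP.ne_top (P.eq_top_of_isUnit_mem hC ((isUnit_iff_ne_zero.mpr hc).map C))

/-- ★ **The regime `c ≠ 0` is ONE-STEP, with explicit strict transforms in all three charts** (`f = y₀y₁ + Ψ`, `Ψ ∈ (y)³`, any field): charts `0`
and `1` by ✓ `A_charts_regular_off_origin₂` (graph charts), chart `2` by `A_ladder_chart₂` (iv) — verbatim the per-chart hypothesis (hone) of the
one-step engines (✓ `OneStep.isRegularLocalRing_localization_blowupAlgebra`), `μ = 2`. [cite: Hartshorne1977, I Thm. 5.1, II Ex. 7.12] -/
theorem A_ladder_oneStep_of_ne_zero {Ψ : MvPolynomial (Fin 3) K} (hΨ : Ψ ∈ Ideal.span (Set.range (X : Fin 3 → MvPolynomial (Fin 3) K)) ^ 3)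
    (hc : ∀ (c : K) (L p₂ : MvPolynomial (Fin 3) K), L.IsHomogeneous 1 → p₂ ∈ Ideal.span (Set.range (X : Fin 3 → MvPolynomial (Fin 3) K)) ^ 2 →
      aeval (fun j => X 2 * Function.update (X : Fin 3 → MvPolynomial (Fin 3) K) 2 1 j) (X 0 * X 1 + Ψ) =
        X 2 ^ 2 * (C c * X 2 + (X 0 * X 1 + X 2 * L) + X 2 * p₂) → c ≠ 0) (l : Fin 3) :
    ∃ G : MvPolynomial (Fin 3) K,
      aeval (fun j => X l * Function.update (X : Fin 3 → MvPolynomial (Fin 3) K) l 1 j) (X 0 * X 1 + Ψ) = X l ^ 2 * G ∧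
      ∀ P : Ideal (MvPolynomial (Fin 3) K), P.IsPrime → (X l : MvPolynomial (Fin 3) K) ∈ P → G ∈ P → ∃ j, pderiv j G ∉ P := by
  obtain ⟨h0, h1, -⟩ := A_charts_regular_off_origin₂ K hΨ
  obtain ⟨c, L, p₂, hL, hp₂, hid, -, -, hiv⟩ := A_ladder_chart₂ K hΨ
  fin_cases l
  · obtain ⟨G, hG, hJ⟩ := h0
    exact ⟨G, hG, fun P hP hX _ => hJ P hP hX⟩
  · obtain ⟨G, hG, hJ⟩ := h1
    exact ⟨G, hG, fun P hP hX _ => hJ P hP hX⟩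
  · exact ⟨_, hid, fun P hP hX _ => hiv (hc c L p₂ hL hp₂ hid) P hP hX⟩

end SecondOrderPoint

end Summit.ResolutionOfSingularities.ResolutionOfSingularities.Cruxes.EquisingularLiftNat.Sections

end
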